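import Mathlib
import Summits.NavierStokesRegularity.NavierStokesRegularity.Theorems.HubbleDynamoHelicityFluxIdentity
import Summits.NavierStokesRegularity.NavierStokesRegularity.Theses.HubbleDynamo
import HarnessLib

/-!
# `HubbleDynamo.HelicityFluxIdentity` (item stmt-NavierStokesRegularity-2060) — closing file

The item was typed on 2026-08-27 (refuter set-signature) as the STEADY helicity-flux identity in
its rigorous `lim_R` cut-off form: for a smooth Leray profile `(U, P)` (`IsLerayProfile ν a U P`) with
Type-I tails `|U|, |P| ≲ (1+|y|)⁻¹`, `|∇U| ≲ (1+|y|)⁻²`, `|∇ curl U| ≲ (1+|y|)⁻³`,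
`a ∫ (y·∇ cutoff_R) ⟪U, curl U⟫ → 2ν ∫ ⟪curl U, curl curl U⟫` as `R → ∞` — the helicity exported
to infinity by the Hubble drift equals the Ohmic destruction of helicity (superhelicity). This is
exactly the accepted tree theorem `Theorems.hubbleDynamo_helicityFluxIdentity`
(`HubbleDynamoHelicityFluxIdentity.lean`, prover pitem-2060, 2026-08-16) with the superhelicity
`∫ ⟪curl U, curl curl U⟫` inlined (`superhelicity_eq_integral_inner`, `rfl`); this file closes the
item by that theorem.

HONEST FRAMING: an integration-by-parts identity about HYPOTHETICAL self-similar / Leray profiles;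
nothing here bears on NS regularity.
-/

noncomputable section

set_option linter.dupNamespace false

namespace Summit.NavierStokesRegularity.NavierStokesRegularity.Theorems

open MeasureTheory Filter Topology Literature.Analysis.FluidPDE
open scoped RealInnerProductSpace

/-- **Item stmt-NavierStokesRegularity-2060** (`HubbleDynamo.HelicityFluxIdentity`): the steady
helicity-flux identity for Leray profiles with Type-I tails, closed by the accepted tree theorem
`hubbleDynamo_helicityFluxIdentity`. [cite: Moffatt1969, §3 (helicity transport); Tsai1998, §3 (Leray profile identities)] -/
theorem hubbleDynamo_helicityFluxIdentity_proof :
    Summit.NavierStokesRegularity.NavierStokesRegularity.Theses.HubbleDynamo.HelicityFluxIdentity := by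
  unfold Summit.NavierStokesRegularity.NavierStokesRegularity.Theses.HubbleDynamo.HelicityFluxIdentity
  intro ν a U P hU hP hprof hdec
  have h := hubbleDynamo_helicityFluxIdentity ν a U P hU hP hprof hdec
  rwa [superhelicity_eq_integral_inner] at h

end Summit.NavierStokesRegularity.NavierStokesRegularity.Theorems

end
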